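import Mathlib
import Literature.AlgebraicGeometry.Resolution.ProjectiveModelsFunctionField
import Literature.AlgebraicGeometry.Resolution.AlterationsDimension
import Literature.AlgebraicGeometry.Resolution.AlterationsBoundarySmoothLocus
import Literature.AlgebraicGeometry.Motives.CartierDivisor
import HarnessLib

/-!
# Route `RadicialJung`, crux `CleanModels` (stmt-ResolutionOfSingularities-15917), line `Sketch` rev 15, stub 4c
# `stub_cleanGlobalization3`: the affine charts of a regular threefold `W`, read in `K(X')` along a birational `X' → W`

For a regular integral `W`, separated of finite type over a field `k`, of dimension `3`, and a dominant `π₁ : X' → W` of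
integral schemes which is birational on function fields, the pull-backs `Aᵢ := π₁^♯ Γ(W, Uᵢ) ⊆ K(X')` of the rings of a
finite affine open cover of `W` are finitely generated `k`-subalgebras with `Frac Aᵢ = K(X')`, `dim Aᵢ ≤ 3`, and ALL maximal
localisations regular of dimension `3` (`exists_regular_charts`) — the «regular affine threefold charts» over which the clean
resolving system of Zariski's patching for clean pairs is built (`exists_model_cleanOn_over_charts`).  The `k`-algebra structure
on `K(X')` is any one whose `Spec` is `Spec K(X') → X' → W → Spec k` (hypothesis `halgW`; e.g. the one read off the structure
morphism of a projective closure).  PROVED; bookkeeping; nothing here proves resolution in characteristic `p`.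
-/

noncomputable section

set_option linter.dupNamespace false -- mandated namespace of this single-conjunct summit

open CategoryTheory AlgebraicGeometry IsLocalRing TopologicalSpace
open Literature.AlgebraicGeometry.Resolution Literature.AlgebraicGeometry.Motives

namespace Summit.ResolutionOfSingularities.ResolutionOfSingularities.Theorems.RadicialJung.CleanModels

section WCharts

variable {k : Type} [Field k] {W X' : Scheme.{0}} [IsIntegral W] [IsIntegral X']
  (f : W ⟶ Spec (.of k)) [LocallyOfFiniteType f]
  (π₁ : X' ⟶ W) [IsDominant π₁] [Algebra k X'.functionField]
  (halgW : Spec.map (CommRingCat.ofHom (algebraMap k X'.functionField)) =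
    X'.fromSpecStalk (genericPoint X') ≫ π₁ ≫ f)

/-- Transport of «all maximal localisations are regular of dimension `3`» along a ring isomorphism. [folklore] -/
theorem forall_maximal_regular_of_ringEquiv {B C : Type} [CommRing B] [CommRing C] (e : B ≃+* C)
    (h : ∀ (𝔪 : Ideal C) [𝔪.IsMaximal], IsRegularLocalRing (Localization.AtPrime 𝔪) ∧ ringKrullDim (Localization.AtPrime 𝔪) = 3)
    (𝔪 : Ideal B) [h𝔪 : 𝔪.IsMaximal] :
    IsRegularLocalRing (Localization.AtPrime 𝔪) ∧ ringKrullDim (Localization.AtPrime 𝔪) = 3 := by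
  let 𝔪' : Ideal C := 𝔪.map (e : B →+* C)
  haveI : 𝔪'.IsMaximal := Ideal.map_isMaximal_of_equiv e
  have hmem' : ∀ c, c ∈ 𝔪' ↔ e.symm c ∈ 𝔪 := fun c => by
    change c ∈ Ideal.map (e : B →+* C) 𝔪 ↔ _
    rw [Ideal.map_comap_of_equiv]
    rfl
  have hM : 𝔪.primeCompl.map e.toMonoidHom = 𝔪'.primeCompl := by
    ext c
    rw [Submonoid.mem_map]
    constructor
    · rintro ⟨b, hb, rfl⟩ hc
      exact hb (by simpa using (hmem' _).mp hc)
    · intro hc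
      exact ⟨e.symm c, fun hb => hc ((hmem' c).mpr hb), e.apply_symm_apply c⟩
  let E : Localization.AtPrime 𝔪 ≃+* Localization.AtPrime 𝔪' :=
    IsLocalization.ringEquivOfRingEquiv (M := 𝔪.primeCompl) (T := 𝔪'.primeCompl)
      (Localization.AtPrime 𝔪) (Localization.AtPrime 𝔪') e hM
  obtain ⟨hreg, hdim⟩ := h 𝔪'
  exact ⟨IsRegularLocalRing.of_ringEquiv E.symm, by rw [ringKrullDim_eq_of_ringEquiv E]; exact hdim⟩

include f halgW in
/-- **One regular chart.**  For a non-empty affine open `U` of the regular threefold `W`, the pull-back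
`A = π₁^♯ Γ(W, U) ⊆ K(X')` is a finitely generated `k`-subalgebra with `Frac A = K(X')`, `dim A ≤ 3`, all maximal localisations
regular of dimension `3`, and consisting exactly of the `π₁^♯` of the sections over `U`. [folklore] -/
theorem exists_regular_chart (hreg : Scheme.IsRegular W) (hdim3 : topologicalKrullDim W = 3)
    (hbij : Function.Bijective (RatFn.functionFieldMap π₁)) (U : W.Opens) (hU : IsAffineOpen U) [hne : Nonempty U] :
    ∃ A : Subalgebra k X'.functionField, A.FG ∧ IsFractionRing A X'.functionField ∧ ringKrullDim A ≤ 3 ∧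
      (∀ (𝔪 : Ideal A.toSubring) [𝔪.IsMaximal],
        IsRegularLocalRing (Localization.AtPrime 𝔪) ∧ ringKrullDim (Localization.AtPrime 𝔪) = 3) ∧
      ∀ z, z ∈ A ↔ ∃ a : Γ(W, U), RatFn.functionFieldMap π₁ (W.germToFunctionField U a) = z := by
  classical
  -- the `k`-structure on `Γ(W, U)` and the embedding `ρ : Γ(W, U) → K(X')`
  let φ : k →+* Γ(W, U) := (f.appLE ⊤ U le_top).hom.comp (Scheme.ΓSpecIso (.of k)).inv.hom
  letI : Algebra k Γ(W, U) := φ.toAlgebra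
  have hft : Algebra.FiniteType k Γ(W, U) := by
    have h1 : RingHom.FiniteType (f.appLE ⊤ U le_top).hom :=
      HasRingHomProperty.appLE @LocallyOfFiniteType f ‹_› ⟨⊤, isAffineOpen_top _⟩ ⟨U, hU⟩ le_top
    exact h1.comp (RingHom.FiniteType.of_surjective _
      (Scheme.ΓSpecIso (.of k)).symm.commRingCatIsoToRingEquiv.surjective)
  let ρ : Γ(W, U) →+* X'.functionField := (RatFn.functionFieldMap π₁).comp (W.germToFunctionField U).hom
  have hρinj : Function.Injective ρ :=
    (RatFn.functionFieldMap π₁).injective.comp (Scheme.germToFunctionField_injective W U)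
  -- `ρ` is compatible with the `k`-structures: both induce `Spec K(X') → X' → W → Spec k`
  have hρk : ∀ c : k, ρ (φ c) = algebraMap k X'.functionField c := by
    have key : CommRingCat.ofHom (ρ.comp φ) = CommRingCat.ofHom (algebraMap k X'.functionField) := by
      apply Spec.map_injective
      rw [halgW]
      have h1 : CommRingCat.ofHom (ρ.comp φ) = ((Scheme.ΓSpecIso (.of k)).inv ≫ f.appLE ⊤ U le_top) ≫
          (W.germToFunctionField U ≫ CommRingCat.ofHom (RatFn.functionFieldMap π₁)) := rfl
      rw [h1]
      simp only [Spec.map_comp, Category.assoc]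
      have h2 : Spec.map (f.appLE ⊤ U le_top) ≫ Spec.map (Scheme.ΓSpecIso (.of k)).inv = hU.fromSpec ≫ f := by
        rw [← Scheme.isoSpec_Spec_inv, ← IsAffineOpen.fromSpec_top]
        exact IsAffineOpen.SpecMap_appLE_fromSpec f (isAffineOpen_top _) hU le_top
      have h3 : Spec.map (W.germToFunctionField U) ≫ hU.fromSpec = W.fromSpecStalk (genericPoint W) :=
        hU.fromSpecStalk_eq_fromSpecStalk
          (((genericPoint_spec W).mem_open_set_iff U.isOpen).mpr ⟨_, Set.mem_univ _, hne.some.2⟩)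
      rw [h2, ← Category.assoc (Spec.map (W.germToFunctionField U)), h3, ← Category.assoc]
      have h4 := specMap_functionFieldMap_fromSpecStalk π₁
      have h5 : (Spec.map (CommRingCat.ofHom (RatFn.functionFieldMap π₁)) ≫ W.fromSpecStalk (genericPoint W)) ≫ f =
          (X'.fromSpecStalk (genericPoint X') ≫ π₁) ≫ f := congrArg (· ≫ f) h4
      exact h5.trans (Category.assoc _ _ _)
    intro c
    exact congrArg (fun g => (CommRingCat.Hom.hom g) c) key
  let ρₐ : Γ(W, U) →ₐ[k] X'.functionField := { ρ with commutes' := hρk }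
  let A : Subalgebra k X'.functionField := ρₐ.range
  have hmemA : ∀ z, z ∈ A ↔ ∃ a : Γ(W, U), RatFn.functionFieldMap π₁ (W.germToFunctionField U a) = z := fun z => by
    change z ∈ ρₐ.range ↔ _
    rw [AlgHom.mem_range ρₐ]
    rfl
  -- `A ≅ Γ(W, U)`
  let eA : Γ(W, U) ≃+* A := RingEquiv.ofBijective (ρₐ.rangeRestrict : Γ(W, U) →+* A)
    ⟨fun a b h => hρinj (congrArg Subtype.val h), fun z => by
      obtain ⟨a, ha⟩ := (AlgHom.mem_range ρₐ).mp z.2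
      exact ⟨a, Subtype.ext ha⟩⟩
  refine ⟨A, ?_, ?_, ?_, ?_, hmemA⟩
  · -- finitely generated
    haveI := hft
    have : A = Subalgebra.map ρₐ ⊤ := (Algebra.map_top ρₐ).symm
    rw [this]
    exact Subalgebra.FG.map _ (Algebra.FiniteType.out)
  · -- `Frac A = K(X')`
    haveI : IsFractionRing Γ(W, U) W.functionField := functionField_isFractionRing_of_isAffineOpen W U hU
    refine IsFractionRing.of_field A X'.functionField fun z => ?_
    obtain ⟨z₀, rfl⟩ := hbij.2 z
    obtain ⟨a, b, -, rfl⟩ := IsFractionRing.div_surjective (A := Γ(W, U)) z₀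
    refine ⟨⟨ρ a, (hmemA _).mpr ⟨a, rfl⟩⟩, ⟨ρ b, (hmemA _).mpr ⟨b, rfl⟩⟩, ?_⟩
    change RatFn.functionFieldMap π₁ (algebraMap Γ(W, U) W.functionField a / algebraMap Γ(W, U) W.functionField b) =
      ρ a / ρ b
    rw [map_div₀]
    rfl
  · -- `dim A ≤ 3`
    have hdimU : ringKrullDim Γ(W, U) = 3 := by
      rw [← topologicalKrullDim_eq_ringKrullDim_of_isAffineOpen f hU ⟨_, hne.some.2⟩]; exact hdim3
    rw [← ringKrullDim_eq_of_ringEquiv eA, hdimU]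
  · -- maximal localisations: `A_𝔪 ≅ Γ(W,U)_𝔫 ≅ 𝒪_{W,x}` regular, of dimension `ht 𝔫 = dim Γ(W,U) = 3`
    intro 𝔪 h𝔪
    have hdimU : ringKrullDim Γ(W, U) = 3 := by
      rw [← topologicalKrullDim_eq_ringKrullDim_of_isAffineOpen f hU ⟨_, hne.some.2⟩]; exact hdim3
    haveI := hft
    have hA : ∀ (𝔫 : Ideal Γ(W, U)) [𝔫.IsMaximal],
        IsRegularLocalRing (Localization.AtPrime 𝔫) ∧ ringKrullDim (Localization.AtPrime 𝔫) = 3 := by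
      intro 𝔫 h𝔫
      let y : PrimeSpectrum Γ(W, U) := ⟨𝔫, h𝔫.isPrime⟩
      have hyU : hU.fromSpec y ∈ U := (Set.ext_iff.mp hU.range_fromSpec _).mp ⟨y, rfl⟩
      letI := TopCat.Presheaf.algebra_section_stalk W.presheaf (⟨hU.fromSpec y, hyU⟩ : U)
      have hloc := hU.isLocalization_stalk' y hyU
      let e : Localization.AtPrime 𝔫 ≃ₐ[Γ(W, U)] W.presheaf.stalk (hU.fromSpec y) :=
        @IsLocalization.algEquiv _ _ 𝔫.primeCompl (Localization.AtPrime 𝔫) _ _ _ (W.presheaf.stalk (hU.fromSpec y)) _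
          (TopCat.Presheaf.algebra_section_stalk W.presheaf (⟨hU.fromSpec y, hyU⟩ : U)) hloc
      haveI : IsRegularLocalRing (W.presheaf.stalk (hU.fromSpec y)) := hreg _
      refine ⟨IsRegularLocalRing.of_ringEquiv e.toRingEquiv.symm, ?_⟩
      rw [IsLocalization.AtPrime.ringKrullDim_eq_height 𝔫 (Localization.AtPrime 𝔫)]
      have h2 := Literature.RingTheory.KrullDimension.ringKrullDim_quotient_add_height k 𝔫
      letI : Field (Γ(W, U) ⧸ 𝔫) := Ideal.Quotient.field 𝔫
      rw [ringKrullDim_eq_zero_of_field, zero_add, hdimU] at h2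
      exact h2
    exact forall_maximal_regular_of_ringEquiv eA.symm (fun 𝔫 _ => hA 𝔫) 𝔪

end WCharts

end Summit.ResolutionOfSingularities.ResolutionOfSingularities.Theorems.RadicialJung.CleanModels

end
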